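import Mathlib.MeasureTheory.Integral.IntervalIntegral.FundThmCalculus
import Literature.MathematicalPhysics.QuantumManyBody.BoseGasWallCutoff
import HarnessLib

/-!
# Monotonicity from a one-sided distributional derivative, via `C¹` plateau bumps

Topic `Literature/MathematicalPhysics/QuantumManyBody` (namespace
`Literature.MathematicalPhysics.QuantumManyBody.BoseGas`, sub-namespace `MarginalSturm`). First of
the support files for the **marginal Sturm package** of the Bose-gas wall-flux bound (crux
`RigidMomentumBound` of `AtomisticToContinuum/BoseEinsteinCondensation`, stub `stub_sturmPackage`):
the one-dimensional Sturm / Picone comparison for the square root `q = √m` of the one-coordinate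
marginal `m` of a ground state near a Dirichlet wall, where `q` is only a *weak* subsolution of
`q'' + μ q ≥ 0`. The comparison is run on the Wronskian `W = q' sin(√μ·) - q (sin(√μ·))'`, whose
derivative is a nonnegative *distribution*; this file turns such one-sided distributional
information into pointwise monotonicity:

* `MarginalSturm.exists_plateau_bump` — for `ε > 0`, `a + ε ≤ b - ε`, a `C¹` function `g ≥ 0`
  vanishing off `(a, b)`, equal to `1` on `[a + ε, b - ε]`, increasing on `[a, a + ε]` and
  decreasing on `[b - ε, b]`: the product `(1 - θ_a) θ_{b-ε}` of two cosine wall profiles of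
  `BoseGasWallCutoff` (`WallCutoff.hasDerivAt_wallProfile` etc.; no definition is introduced).
* `MarginalSturm.le_of_forall_integral_deriv_mul_nonpos` — if `W` is continuous on `[a, b]` and
  `∫_a^b g' W ≤ 0` for all such `g`, then `W a ≤ W b` (the ramps of the bump average `W` near the
  two endpoints; let the ramp width tend to `0`).

Standard real analysis (the `C¹` version of "a distribution with nonnegative derivative is a
nondecreasing function"), tagged folklore. Deliberately NOT here: the `L¹_loc` version, mollifiers.
-/

noncomputable section

namespace Literature.MathematicalPhysics.QuantumManyBody.BoseGas

open _root_.MeasureTheory _root_.Filter _root_.Set _root_.Real intervalIntegral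
open scoped Topology

namespace MarginalSturm

/-- The slope of the cosine wall profile of `BoseGasWallCutoff` is nonpositive (the profile is
non-increasing). [folklore] -/
theorem wallProfileDeriv_nonpos {w : ℝ} (hw : 0 < w) (a t : ℝ) :
    -(π / w) * sin (π * max 0 (min 1 ((t - a) / w))) / 2 ≤ 0 := by
  have h0 : 0 ≤ max 0 (min 1 ((t - a) / w)) := le_max_left _ _
  have h1 : max 0 (min 1 ((t - a) / w)) ≤ 1 := max_le zero_le_one (min_le_left _ _)
  have hs : 0 ≤ sin (π * max 0 (min 1 ((t - a) / w))) :=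
    sin_nonneg_of_nonneg_of_le_pi (mul_nonneg pi_pos.le h0) (mul_le_of_le_one_right pi_pos.le h1)
  have hpw : 0 < π / w := div_pos pi_pos hw
  have : 0 ≤ (π / w) * sin (π * max 0 (min 1 ((t - a) / w))) := mul_nonneg hpw.le hs
  linarith

/-- **A `C¹` plateau bump with signed ramps.** For `ε > 0` and `a + ε ≤ b - ε` there is a `C¹`
function `g ≥ 0` vanishing on `(-∞, a] ∪ [b, ∞)`, equal to `1` at `a + ε` and `b - ε`, with
`g' ≥ 0` on `[a, a + ε]`, `g' = 0` on `[a + ε, b - ε]`, `g' ≤ 0` on `[b - ε, b]` (namely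
`(1 - θ_a) θ_{b-ε}` for the cosine wall profile `θ_c` of width `ε`). [folklore] -/
theorem exists_plateau_bump {a b ε : ℝ} (hε : 0 < ε) (hab : a + ε ≤ b - ε) :
    ∃ g : ℝ → ℝ, ContDiff ℝ 1 g ∧ (∀ x, 0 ≤ g x) ∧ (∀ x, x ≤ a → g x = 0) ∧
      (∀ x, b ≤ x → g x = 0) ∧ g (a + ε) = 1 ∧ g (b - ε) = 1 ∧
      (∀ x ∈ Icc a (a + ε), 0 ≤ deriv g x) ∧ (∀ x ∈ Icc (a + ε) (b - ε), deriv g x = 0) ∧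
      (∀ x ∈ Icc (b - ε) b, deriv g x ≤ 0) := by
  set θa : ℝ → ℝ := fun s => (1 + cos (π * max 0 (min 1 ((s - a) / ε)))) / 2 with hθa
  set θa' : ℝ → ℝ := fun s => -(π / ε) * sin (π * max 0 (min 1 ((s - a) / ε))) / 2 with hθa'
  set θb : ℝ → ℝ := fun s => (1 + cos (π * max 0 (min 1 ((s - (b - ε)) / ε)))) / 2 with hθb
  set θb' : ℝ → ℝ := fun s => -(π / ε) * sin (π * max 0 (min 1 ((s - (b - ε)) / ε))) / 2
    with hθb'
  have hda : ∀ x, HasDerivAt θa (θa' x) x := fun x => WallCutoff.hasDerivAt_wallProfile hε x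
  have hdb : ∀ x, HasDerivAt θb (θb' x) x := fun x => WallCutoff.hasDerivAt_wallProfile hε x
  have hd : ∀ x, HasDerivAt (fun s => (1 - θa s) * θb s)
      ((0 - θa' x) * θb x + (1 - θa x) * θb' x) x := fun x =>
    ((hasDerivAt_const x (1 : ℝ)).sub (hda x)).mul (hdb x)
  have hderiv : ∀ x, deriv (fun s => (1 - θa s) * θb s) x =
      (0 - θa' x) * θb x + (1 - θa x) * θb' x := fun x => (hd x).deriv
  refine ⟨fun s => (1 - θa s) * θb s, ?_, ?_, ?_, ?_, ?_, ?_, ?_, ?_, ?_⟩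
  · exact (contDiff_const.sub (WallCutoff.contDiff_wallProfile hε)).mul
      (WallCutoff.contDiff_wallProfile hε)
  · intro x
    have h1 := (WallCutoff.wallProfile_mem a ε x).2
    have h2 := (WallCutoff.wallProfile_mem (b - ε) ε x).1
    exact mul_nonneg (by simp only [hθa]; linarith) h2
  · intro x hx
    simp only [hθa, WallCutoff.wallProfile_of_le hε hx, sub_self, zero_mul]
  · intro x hx
    simp only [hθb, WallCutoff.wallProfile_of_ge hε (show b - ε + ε ≤ x by linarith), mul_zero]
  · simp only [hθa, hθb, WallCutoff.wallProfile_of_ge hε (le_refl (a + ε)),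
      WallCutoff.wallProfile_of_le hε hab]
    norm_num
  · simp only [hθa, hθb, WallCutoff.wallProfile_of_ge hε hab,
      WallCutoff.wallProfile_of_le hε (le_refl (b - ε))]
    norm_num
  · intro x hx
    rw [hderiv x]
    have h1 : θb x = 1 := WallCutoff.wallProfile_of_le hε (hx.2.trans hab)
    have h2 : θb' x = 0 := WallCutoff.wallProfileDeriv_of_le hε (hx.2.trans hab)
    have h3 : θa' x ≤ 0 := wallProfileDeriv_nonpos hε a x
    rw [h1, h2]
    linarith
  · intro x hx
    rw [hderiv x]
    have h1 : θa' x = 0 := WallCutoff.wallProfileDeriv_of_ge hε hx.1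
    have h2 : θb' x = 0 := WallCutoff.wallProfileDeriv_of_le hε hx.2
    rw [h1, h2]
    ring
  · intro x hx
    rw [hderiv x]
    have h1 : θa x = 0 := WallCutoff.wallProfile_of_ge hε (hab.trans hx.1)
    have h2 : θa' x = 0 := WallCutoff.wallProfileDeriv_of_ge hε (hab.trans hx.1)
    have h3 : θb' x ≤ 0 := wallProfileDeriv_nonpos hε (b - ε) x
    rw [h1, h2]
    linarith

/-- **Monotonicity from a one-sided distributional derivative.** Let `W` be continuous on
`[a, b]`, `a < b`, and suppose `∫_a^b g' W ≤ 0` for every `C¹` function `g ≥ 0` vanishing on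
`(-∞, a] ∪ [b, ∞)` (i.e. the distribution `W'` is `≥ 0` on `(a, b)`). Then `W a ≤ W b`: test with
the plateau bumps of `exists_plateau_bump`, whose rising and falling ramps average `W` near `a` and
near `b`. [folklore] -/
theorem le_of_forall_integral_deriv_mul_nonpos {W : ℝ → ℝ} {a b : ℝ} (hab : a < b)
    (hW : ContinuousOn W (Icc a b))
    (h : ∀ g : ℝ → ℝ, ContDiff ℝ 1 g → (∀ x, 0 ≤ g x) → (∀ x, x ≤ a → g x = 0) →
      (∀ x, b ≤ x → g x = 0) → ∫ x in a..b, deriv g x * W x ≤ 0) :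
    W a ≤ W b := by
  by_contra hlt
  rw [not_le] at hlt
  set δ : ℝ := (W a - W b) / 4 with hδ
  have hδpos : 0 < δ := by rw [hδ]; linarith
  -- uniform closeness near the two endpoints
  obtain ⟨ε₁, hε₁, h₁⟩ := Metric.continuousWithinAt_iff.1 (hW a (left_mem_Icc.2 hab.le)) δ hδpos
  obtain ⟨ε₂, hε₂, h₂⟩ := Metric.continuousWithinAt_iff.1 (hW b (right_mem_Icc.2 hab.le)) δ hδpos
  set ε : ℝ := min (min ε₁ ε₂) ((b - a) / 2) / 2 with hε
  have hεpos : 0 < ε := by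
    rw [hε]; exact half_pos (lt_min (lt_min hε₁ hε₂) (by linarith))
  have hεle : min (min ε₁ ε₂) ((b - a) / 2) ≤ (b - a) / 2 := min_le_right _ _
  have hε₁' : ε < ε₁ := by
    have : min (min ε₁ ε₂) ((b - a) / 2) ≤ ε₁ := (min_le_left _ _).trans (min_le_left _ _)
    rw [hε]; linarith [lt_min (lt_min hε₁ hε₂) (show 0 < (b - a) / 2 by linarith)]
  have hε₂' : ε < ε₂ := by
    have : min (min ε₁ ε₂) ((b - a) / 2) ≤ ε₂ := (min_le_left _ _).trans (min_le_right _ _)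
    rw [hε]; linarith [lt_min (lt_min hε₁ hε₂) (show 0 < (b - a) / 2 by linarith)]
  have hgap : a + ε ≤ b - ε := by rw [hε]; linarith
  obtain ⟨g, hg, hg0, hga, hgb, hga1, hgb1, hda, hdm, hdb⟩ := exists_plateau_bump hεpos hgap
  have hneg := h g hg hg0 hga hgb
  -- continuity / integrability of `g' W` on `[a, b]`
  have hgc : Continuous (deriv g) := hg.continuous_deriv le_rfl
  have hcont : ContinuousOn (fun x => deriv g x * W x) (Icc a b) :=
    hgc.continuousOn.mul hW
  have hii : ∀ c d, c ∈ Icc a b → d ∈ Icc a b →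
      IntervalIntegrable (fun x => deriv g x * W x) volume c d := fun c d hc hd =>
    (hcont.mono (uIcc_subset_Icc hc hd)).intervalIntegrable
  have hma : a + ε ∈ Icc a b := ⟨by linarith, by linarith⟩
  have hmb : b - ε ∈ Icc a b := ⟨by linarith, by linarith⟩
  have ha' : a ∈ Icc a b := left_mem_Icc.2 hab.le
  have hb' : b ∈ Icc a b := right_mem_Icc.2 hab.le
  -- split the integral into the three pieces
  have hsplit : ∫ x in a..b, deriv g x * W x =
      (∫ x in a..(a + ε), deriv g x * W x) + (∫ x in (a + ε)..(b - ε), deriv g x * W x) +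
        ∫ x in (b - ε)..b, deriv g x * W x := by
    rw [integral_add_adjacent_intervals (hii _ _ ha' hma) (hii _ _ hma hmb),
      integral_add_adjacent_intervals ((hii _ _ ha' hma).trans (hii _ _ hma hmb)) (hii _ _ hmb hb')]
  -- middle piece vanishes
  have hmid : ∫ x in (a + ε)..(b - ε), deriv g x * W x = 0 := by
    rw [integral_congr (g := fun _ => (0 : ℝ)) fun x hx => ?_, intervalIntegral.integral_zero]
    rw [uIcc_of_le hgap] at hx
    simp [hdm x hx]
  -- rising ramp: `∫ g' W ≥ (W a - δ) ∫ g' = W a - δ`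
  have hIa : ∫ x in a..(a + ε), deriv g x = 1 := by
    rw [integral_deriv_eq_sub (fun x _ => (hg.differentiable one_ne_zero) x)
      (hgc.intervalIntegrable _ _), hga1, hga a le_rfl, sub_zero]
  have hleft : W a - δ ≤ ∫ x in a..(a + ε), deriv g x * W x := by
    have h1 : ∫ x in a..(a + ε), deriv g x * (W a - δ) ≤ ∫ x in a..(a + ε), deriv g x * W x := by
      refine integral_mono_on (by linarith) ((hgc.mul continuous_const).intervalIntegrable _ _)
        (hii _ _ ha' hma) fun x hx => ?_
      refine mul_le_mul_of_nonneg_left ?_ (hda x hx)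
      have hx' : x ∈ Icc a b := ⟨hx.1, hx.2.trans hma.2⟩
      have hdist : dist x a < ε₁ := by
        rw [Real.dist_eq, abs_of_nonneg (by linarith [hx.1])]; linarith [hx.2]
      have := h₁ hx' hdist
      rw [Real.dist_eq] at this
      linarith [(abs_lt.1 this).1]
    rw [intervalIntegral.integral_mul_const, hIa, one_mul] at h1
    exact h1
  -- falling ramp: `∫ g' W ≥ (W b + δ) ∫ g' = -(W b + δ)`
  have hIb : ∫ x in (b - ε)..b, deriv g x = -1 := by
    rw [integral_deriv_eq_sub (fun x _ => (hg.differentiable one_ne_zero) x)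
      (hgc.intervalIntegrable _ _), hgb1, hgb b le_rfl]
    norm_num
  have hright : -(W b + δ) ≤ ∫ x in (b - ε)..b, deriv g x * W x := by
    have h1 : ∫ x in (b - ε)..b, deriv g x * (W b + δ) ≤ ∫ x in (b - ε)..b, deriv g x * W x := by
      refine integral_mono_on (by linarith) ((hgc.mul continuous_const).intervalIntegrable _ _)
        (hii _ _ hmb hb') fun x hx => ?_
      refine mul_le_mul_of_nonpos_left ?_ (hdb x hx)
      have hx' : x ∈ Icc a b := ⟨hmb.1.trans hx.1, hx.2⟩
      have hdist : dist x b < ε₂ := by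
        rw [Real.dist_eq, abs_of_nonpos (by linarith [hx.2])]; linarith [hx.1]
      have := h₂ hx' hdist
      rw [Real.dist_eq] at this
      linarith [(abs_lt.1 this).2]
    rw [intervalIntegral.integral_mul_const, hIb] at h1
    linarith
  rw [hsplit, hmid, add_zero] at hneg
  linarith

end MarginalSturm

end Literature.MathematicalPhysics.QuantumManyBody.BoseGas
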